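import Mathlib.Algebra.Order.Floor.Defs
import Mathlib.Data.Finset.SymmDiff
import Mathlib.Data.Fintype.Card
import Literature.ModelTheory.FiniteModelTheory.CountingWidthParameter
import Literature.ModelTheory.FiniteModelTheory.CkEquivTransfer
import Literature.ModelTheory.FiniteModelTheory.TseitinColouring
import Literature.Computability.Complexity.RoundInstance
import HarnessLib

/-!
# Discharges of the named facts of `CountingWidthParameter.lean`: `exists_countingWidth_linear`
# (linear counting width of 3-colourability) and `caiFurerImmerman_cfiEquiv` (CFI 1992, Thm 6.4)

## Part I — a graph property of linear counting width exists (`exists_countingWidth_linear_holds`)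

Topic `Literature/ModelTheory/FiniteModelTheory`; sibling proof file of `CountingWidthParameter.lean`
(kept separate because the proof imports the explicit expander family of
`Literature.Computability.Complexity.RoundInstance`, which the definitional file should not depend on).

`exists_countingWidth_linear` (Dawar–Wilsenach 2025, §2.4, p. 6: "Cai, Fürer and Immerman [9] …
construct a graph property with counting width Ω(n). Since then, many graph properties have been shown
to have linear counting width, including Hamiltonicity and 3-colourability (see [5])") asks for an
isomorphism-closed class `𝒞` of finite graphs and a constant `c` with `n ≤ c · countingWidth 𝒞 n` for all
large `n`.

## The proof (and where it deviates from the printed attribution)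

Dawar–Wilsenach attribute the first such property to the Cai–Fürer–Immerman graphs over 3-regular
graphs without small separators; in the tree that game theorem is the NAMED FACT
`caiFurerImmerman_cfiEquiv` (discharged in Part II below). The same sentence of the source names
3-COLOURABILITY (Atserias–Dawar–Ochremiak 2021, Lemma 13 of arXiv:1901.07825), and for that property
every ingredient is PROVED in the tree, so the existential is discharged through it:

* `TseitinColouring.graph R c` — the 3-colouring encoding of the parity (Tseitin) system of a `d`-regular
  rotation map `R` with charges `c` (`TseitinColouring.lean`): `graph R 0` is 3-colourable
  (`colorable_zero`), `graph R c` is not when `∑ c ≠ 0` and `d ≥ 2` (`not_colorable_of_sum_ne_zero`), and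
  Duplicator wins the bijective `K`-pebble game between them whenever `R` is an `η`-edge-expander on
  `m ≥ 2` vertices and `2 d K < η m` (`ckEquiv_graph` — Atserias–Dawar 2019, Lemma 3.2, the strategy from
  local consistency, going back to Cai–Fürer–Immerman 1992, §6);
* the explicit `d₀`-regular edge expanders `Expander.Family.X m` on EVERY number `m` of vertices with the
  uniform constant `Expander.Family.η` (`Expander.Family.edgeExpansion_X`, zig-zag construction,
  `RoundInstance.lean`);
* transport of `≡^{C^K}` along isomorphisms to graphs on `Fin N`, `N = m · per d₀ + 3`
  (`CkEquiv.iso_congr`, `TseitinColouring.card_vert`), and the witness lower bound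
  `IsIsoClosed.lt_countingWidth` for the isomorphism-closed class of 3-colourable finite graphs
  (`isIsoClosed_colorable_three`).

Witnesses therefore exist at every order `N_m = m · per d₀ + 3`, `m ≥ 2`, with `K` any value below
`η m / (2 d₀)`; for `n` between `N_m` and `N_{m+1}` the witnesses of order `N_m ≤ n` still count
(`countingWidth` concerns members with AT MOST `n` vertices), which gives
`n ≤ ⌈4 d₀ (per d₀ + 3) / η⌉ · countingWidth 𝒞 n` for all `n ≥ 2 · per d₀ + 3`.

## Part II — the Cai–Fürer–Immerman theorem in game form (`caiFurerImmerman_cfiEquiv_holds`)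

Part II proves the other NAMED FACT of `CountingWidthParameter.lean`,
`caiFurerImmerman_cfiEquiv` (Cai–Fürer–Immerman 1992, Thm 6.4 with Def. 6.3): if every
separator of the (connected) base graph `T` has at least `s + 1` vertices, Duplicator wins the
bijective `s`-pebble game (`CkEquiv s`, file `CkEquiv.lean`) on the untwisted CFI graph
`cfiEven T = CFI(T, ∅)` and the once-twisted `CFI(T, {e})` (file `CFI.lean`). It uses only
`CountingWidthParameter.lean` and its imports (`CFI.lean`, `CkEquiv.lean`).

We follow the architecture of CFI's proof of Thm 6.4 (FOCS 1989 version, pp. 16–18: the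
observation opening the proof of Lemma 6.2, Def. 6.3, and the invariant `(*)` of the proof of
Thm 6.4 — "she keeps this twisted edge inside of `Q_r`. With only `s` pebbles, Player I cannot
break apart `Q_r` to expose the twist"), transposed to the bijective-game presentation of
`≡_{C^s}` used by the tree's `CkEquiv` (Hella 1996): Duplicator's announced bijection is
assembled gadget by gadget from the isomorphisms `θ_{r,g}` of `(*)`.

* GAUGE ISOMORPHISMS (`gaugeIso`; CFI Lemma 6.2 "local isomorphisms", composed). A marking `g`
  of darts of `T` with an even number of marked darts at every vertex acts on the CFI vertex
  set: an end vertex `(u, w, c)` goes to `(u, w, c ⊕ g(u,w))`, a gadget vertex `m_{u,S}` to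
  `m_{u, S Δ {w | g(u,w)}}`. This is an isomorphism `CFI(T, X) ≅ CFI(T, X')` whenever `X'`
  differs from `X` exactly at the edges `{u,w}` with `g(u,w) ≠ g(w,u)`; it preserves gadgets and
  is the identity on every gadget without marked darts.
* MOVING THE TWIST (`exists_gauge`). Along a walk `a = z₀, …, z_m = b` of `T` with darts
  `x ~ a`, `b ~ y`, marking at each `zᵢ` the two darts towards its predecessor and successor
  gives an even marking supported on the walk whose boundary is `{x,a} Δ {b,y}`: the twist moves
  from the edge `{x,a}` to `{b,y}` by an isomorphism fixing all gadgets off the walk.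
* THE BIG COMPONENT (`bigPart`). For a set `B` of base vertices, `bigPart B` is the set of
  vertices from which more than `v/2` vertices are reachable avoiding `B`; it is antitone in
  `B`, any two of its vertices are joined by a walk avoiding `B` (two disjoint reachability sets
  of size `> v/2` cannot coexist), and it contains an edge as soon as `B` is NOT a separator in
  the sense of `IsCFISeparator` (CFI Def. 6.3) — which, under the hypothesis of the theorem, is
  the case for every `B` with `|B| ≤ s`.
* THE STRATEGY (`cfiStrategyCarrier`). Winning positions: at most `s` pebble pairs `p`, an edge
  `{a,b}` with both ends in the big component of `T` minus the base vertices of the pebbled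
  vertices, and a gadget-preserving isomorphism `φ : CFI(T,{a,b}) ≅ CFI(T,{e})` whose graph
  contains `p` ("the twist is hidden in the big component", CFI proof of Thm 6.4). Such `p` is a
  partial isomorphism `CFI(T,∅) ⇀ CFI(T,{e})` because `CFI(T,∅)` and `CFI(T,{a,b})` agree off the
  gadgets of `a`, `b`, which carry no pebble. FORTH: for every base vertex `z` the big component of
  `B(p) ∪ {z}` (still `≤ s` vertices) contains an edge `{a',b'}` and lies inside the current big
  component, so the twist moves from `{a,b}` to `{a',b'}` by a gauge isomorphism `ψ_z` fixing the
  pebbled gadgets; Duplicator's bijection is `x ↦ (ψ_{base x} ≫ φ) x`, assembled gadget by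
  gadget (it is injective, hence bijective, as all maps preserve gadgets), and whatever `x`
  Spoiler pebbles, the new position lies on the graph of `ψ_{base x} ≫ φ`.

The hypothesis "minimum degree `≥ 2`" of the named fact (CFI's standing assumption for the
construction `X(T)`) is not needed for the game argument and is not used.

## References

Part I:
* A. Dawar, G. Wilsenach, *Symmetric arithmetic circuits*, Theory of Computing 21 (2025), art. 14,
  §2.4 and Def. 2.1, p. 6. Read: `lit read doi:10.4086/toc.2025.v021a014`, p. 6.
* A. Atserias, A. Dawar, J. Ochremiak, *On the power of symmetric linear programs*, J. ACM 68 (2021)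
  Art. 26, arXiv:1901.07825, §5.2, Lemma 13 (linear counting width of 3-colourability).
* A. Atserias, A. Dawar, *Definable inapproximability: new challenges for duplicator*, J. Logic
  Comput. 29 (2019), Lemma 3.2 (the strategy), Thm 3.7.
* J.-Y. Cai, M. Fürer, N. Immerman, *An optimal lower bound on the number of variables for graph
  identification*, Combinatorica 12 (1992), §6, Cor. 6.5.

Part II:
* [CaiFurerImmerman1992] J.-Y. Cai, M. Fürer, N. Immerman, *An optimal lower bound on the number
  of variables for graph identification*, Combinatorica 12 (1992) 389–410 (FOCS 1989,
  doi:10.1109/sfcs.1989.63543), §6: Lemma 6.1, Lemma 6.2 (and the observation opening its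
  proof: twisting two edges at a common vertex gives an isomorphic graph), Def. 6.3 (separator),
  Thm 6.4 (`X(T) ≡_{C^s} X̃(T)`) with its proof (largest component `Q_r` of `T − P_r`,
  invariant `(*)`). Read: FOCS version pp. 16–18 (`lit read doi:10.1109/sfcs.1989.63543`).
* [Hella1996] L. Hella, *Logical hierarchies in PTIME*, Inform. and Comput. 129 (1996) 1–19
  (the bijective pebble game; see `CkEquiv.lean`).
-/

namespace Literature.ModelTheory.FiniteModelTheory

open Filter
open Literature.Computability.Complexity.Expander

/-! ### The witnesses: Tseitin 3-colouring graphs over the zig-zag cloud expanders -/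

namespace ExistsCountingWidthLinear

/-- The degree `d₀ = 2B · D²` of the cloud expanders is at least `2` (indeed `B, D ≥ 2`). [folklore] -/
theorem two_le_d₀ : 2 ≤ Family.d₀ := by
  have hB := Family.two_le_B
  have hDD : 0 < Family.D * Family.D := Nat.mul_pos Family.D_pos Family.D_pos
  show 2 ≤ 2 * Family.B * (Family.D * Family.D)
  calc 2 ≤ 2 * Family.B := by omega
    _ ≤ 2 * Family.B * (Family.D * Family.D) := Nat.le_mul_of_pos_right _ hDD

/-- The cloud expanders `Family.X m` are `η`-edge-expanders in the sense of `TseitinColouring`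
(`Family.edgeExpansion_X`). [cite: AroraBarakCC2009, Exercise 21.16 and Claim 22.37] -/
theorem edgeExpansion_X (m : ℕ) : TseitinColouring.EdgeExpansion (Family.X m) Family.η :=
  ⟨Family.η_pos, fun Q hQ => Family.edgeExpansion_X m Q hQ⟩

/-- **The witnesses.** For `m ≥ 2` and `2 d₀ K < η m` there are two graphs on
`Fin (m · per d₀ + 3)`, the first 3-colourable, the second not, which are `≡^{C^K}`: the Tseitin
3-colouring graphs `H(X m, 0)` and `H(X m, c)` with a single unit charge, transported to `Fin _`
(Atserias–Dawar–Ochremiak 2021, proof of Lemma 13, over the tree's explicit expanders).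
[cite: AtseriasDawarOchremiak2021, §5.2, Lemma 13 of arXiv:1901.07825 (proof)] -/
theorem exists_witnesses {m K : ℕ} (hm : 2 ≤ m)
    (hK : (2 * Family.d₀ * K : ℝ) < Family.η * m) :
    ∃ G H : SimpleGraph (Fin (m * TseitinColouring.per Family.d₀ + 3)),
      CkEquiv K G H ∧ G.Colorable 3 ∧ ¬ H.Colorable 3 := by
  classical
  have hd1 : 1 ≤ Family.d₀ := le_trans (by norm_num) two_le_d₀
  -- a single unit charge at vertex `0`: odd total charge
  set c : Fin m → ZMod 2 := fun w => if w = ⟨0, by omega⟩ then 1 else 0 with hc_def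
  have hc : (∑ w, c w) ≠ 0 := by
    rw [show (∑ w, c w) = 1 from by simp [hc_def]]
    decide
  have hequiv : CkEquiv K (TseitinColouring.graph (Family.X m) c)
      (TseitinColouring.graph (Family.X m) 0) :=
    TseitinColouring.ckEquiv_graph (edgeExpansion_X m) c hm hd1 hK
  -- transport to `Fin N`
  let e : TseitinColouring.Vert m Family.d₀ ≃ Fin (m * TseitinColouring.per Family.d₀ + 3) :=
    (Fintype.equivFin _).trans (finCongr (TseitinColouring.card_vert m Family.d₀))
  refine ⟨_, _, hequiv.symm.iso_congr (SimpleGraph.Iso.map e _) (SimpleGraph.Iso.map e _), ?_, ?_⟩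
  · exact (TseitinColouring.colorable_zero (R := Family.X m)).of_hom (SimpleGraph.Iso.map e _).symm.toHom
  · intro h
    exact TseitinColouring.not_colorable_of_sum_ne_zero two_le_d₀ hc
      (h.of_hom (SimpleGraph.Iso.map e _).toHom)

/-- Hence, for the class of 3-colourable finite graphs, every `K` with `2 d₀ K < η m` lies below the
counting width at any `n ≥ m · per d₀ + 3` (`m ≥ 2`). [cite: AtseriasDawarOchremiak2021, §5.2,
Lemma 13 of arXiv:1901.07825] -/
theorem lt_countingWidth_colorable {m K n : ℕ} (hm : 2 ≤ m)
    (hK : (2 * Family.d₀ * K : ℝ) < Family.η * m) (hn : m * TseitinColouring.per Family.d₀ + 3 ≤ n) :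
    K < countingWidth {A : FinGraph | A.2.Colorable 3} n := by
  obtain ⟨G, H, hGH, hG, hH⟩ := exists_witnesses hm hK
  exact isIsoClosed_colorable_three.lt_countingWidth (G := ⟨_, G⟩) (H := ⟨_, H⟩) hn hn hGH hG hH

/-- The counting width of 3-colourability at `n ≥ m · per d₀ + 3` (`m ≥ 2`) is at least
`η m / (2 d₀)`. [cite: AtseriasDawarOchremiak2021, §5.2, Lemma 13 of arXiv:1901.07825] -/
theorem eta_mul_le_countingWidth_colorable {m n : ℕ} (hm : 2 ≤ m)
    (hn : m * TseitinColouring.per Family.d₀ + 3 ≤ n) :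
    Family.η * m ≤ (2 * Family.d₀ * countingWidth {A : FinGraph | A.2.Colorable 3} n : ℝ) := by
  by_contra h
  exact lt_irrefl _ (lt_countingWidth_colorable hm (not_le.mp h) hn)

end ExistsCountingWidthLinear

/-! ### The discharge -/

open ExistsCountingWidthLinear in
/-- **Linear counting width of 3-colourability, with explicit constants**: for every
`n ≥ 2 · per d₀ + 3`, `n ≤ ⌈4 d₀ (per d₀ + 3) / η⌉ · countingWidth {3-colourable} n`
(Atserias–Dawar–Ochremiak 2021, Lemma 13, as quoted by Dawar–Wilsenach 2025, §2.4; here over the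
tree's explicit zig-zag expanders, whence the constants). [cite: AtseriasDawarOchremiak2021, §5.2, Lemma 13 of arXiv:1901.07825] -/
theorem le_mul_countingWidth_colorable_three {n : ℕ}
    (hn : 2 * TseitinColouring.per Family.d₀ + 3 ≤ n) :
    n ≤ ⌈(4 * Family.d₀ * (TseitinColouring.per Family.d₀ + 3) / Family.η : ℝ)⌉₊ *
      countingWidth {A : FinGraph | A.2.Colorable 3} n := by
  have hd1 : 1 ≤ Family.d₀ := le_trans (by norm_num) two_le_d₀
  have hP : 0 < TseitinColouring.per Family.d₀ := TseitinColouring.per_pos _ hd1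
  -- the largest `m` with `m · per d₀ + 3 ≤ n`; it is at least `2`
  have hm2 : 2 ≤ (n - 3) / TseitinColouring.per Family.d₀ :=
    (Nat.le_div_iff_mul_le hP).2 (by omega)
  have hmn : (n - 3) / TseitinColouring.per Family.d₀ * TseitinColouring.per Family.d₀ + 3 ≤ n := by
    have := Nat.div_mul_le_self (n - 3) (TseitinColouring.per Family.d₀)
    omega
  have hlt : n < (n - 3) / TseitinColouring.per Family.d₀ * TseitinColouring.per Family.d₀ +
      TseitinColouring.per Family.d₀ + 3 := by
    have := Nat.lt_div_mul_add (a := n - 3) hP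
    omega
  -- the counting width at `n` is at least `η m / (2 d₀)`
  have hηm := eta_mul_le_countingWidth_colorable hm2 hmn
  generalize (n - 3) / TseitinColouring.per Family.d₀ = m at hm2 hmn hlt hηm
  generalize TseitinColouring.per Family.d₀ = P at hP hmn hlt
  generalize countingWidth {A : FinGraph | A.2.Colorable 3} n = cw at hηm
  -- real arithmetic: `n < (m + 1) P + 3 ≤ 2 m (P + 3) ≤ (4 d₀ (P + 3) / η) · cw`
  have hη : 0 < Family.η := Family.η_pos
  have hη' : Family.η ≠ 0 := ne_of_gt hη
  have hnR : (n : ℝ) < m * P + P + 3 := by exact_mod_cast hlt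
  have hm2R : (2 : ℝ) ≤ m := by exact_mod_cast hm2
  have hPR : (1 : ℝ) ≤ P := by exact_mod_cast hP
  have h1 : (n : ℝ) ≤ 2 * m * (P + 3) := by
    nlinarith [mul_nonneg (sub_nonneg.2 hm2R) (sub_nonneg.2 hPR)]
  have hc₀ := Nat.le_ceil (4 * Family.d₀ * (P + 3) / Family.η : ℝ)
  have key : (n : ℝ) ≤ ⌈(4 * Family.d₀ * (P + 3) / Family.η : ℝ)⌉₊ * (cw : ℝ) :=
    calc (n : ℝ) ≤ 2 * m * (P + 3) := h1
      _ = (2 * (P + 3) / Family.η) * (Family.η * m) := by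
          rw [div_mul_eq_mul_div, eq_div_iff hη']; ring
      _ ≤ (2 * (P + 3) / Family.η) * (2 * Family.d₀ * cw) :=
          mul_le_mul_of_nonneg_left hηm (by positivity)
      _ = (4 * Family.d₀ * (P + 3) / Family.η) * cw := by ring
      _ ≤ ⌈(4 * Family.d₀ * (P + 3) / Family.η : ℝ)⌉₊ * (cw : ℝ) :=
          mul_le_mul_of_nonneg_right hc₀ (by positivity)
  have key' : ((n : ℕ) : ℝ) ≤ ((⌈(4 * Family.d₀ * (P + 3) / Family.η : ℝ)⌉₊ * cw : ℕ) : ℝ) := by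
    rwa [Nat.cast_mul]
  exact Nat.cast_le.1 key'

/-- **Discharge of `exists_countingWidth_linear`**: a graph property of counting width `Ω(n)` exists —
the class of 3-colourable finite graphs, `c = ⌈4 d₀ (per d₀ + 3) / η⌉` (Dawar–Wilsenach 2025, §2.4,
p. 6: "they construct a graph property with counting width Ω(n) … many graph properties have been
shown to have linear counting width, including Hamiltonicity and 3-colourability (see [5])"; proved
here along the 3-colourability road of Atserias–Dawar–Ochremiak, whose mechanism the tree proves in
`TseitinColouring.lean`, rather than along the CFI road, whose game theorem is the named fact
`caiFurerImmerman_cfiEquiv`). [cite: DawarWilsenach2025, §2.4 (a graph property with counting width Ω(n)), p. 6] -/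
theorem exists_countingWidth_linear_holds : exists_countingWidth_linear :=
  ⟨{A : FinGraph | A.2.Colorable 3}, isIsoClosed_colorable_three,
    ⌈(4 * Family.d₀ * (TseitinColouring.per Family.d₀ + 3) / Family.η : ℝ)⌉₊,
    eventually_atTop.2 ⟨2 * TseitinColouring.per Family.d₀ + 3,
      fun _ hn => le_mul_countingWidth_colorable_three hn⟩⟩

/-! ## Part II — the Cai–Fürer–Immerman theorem in game form -/

open Finset
open scoped symmDiff

section Gauge

variable {v : ℕ} (G : SimpleGraph (Fin v)) [DecidableRel G.Adj]

/-! ### The base projection -/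

/-- The base vertex (gadget) of a CFI vertex: `m_{u,S} ↦ u`, `(u, w, c) ↦ u`.
[Cai–Fürer–Immerman 1992, §6] [folklore] -/
def cfiBase : CFIVertex G → Fin v
  | .inl x => x.1
  | .inr x => x.1.1.1

/-- Adjacency in `CFI(G, T)` reads the twist set only at the edge joining the two base
vertices. [Cai–Fürer–Immerman 1992, §6] [folklore] -/
theorem cfiGraph_adj_congr_of_base {T T' : Set (Sym2 (Fin v))} [DecidablePred (· ∈ T)]
    [DecidablePred (· ∈ T')] {x y : CFIVertex G}
    (h : s(cfiBase G x, cfiBase G y) ∈ T ↔ s(cfiBase G x, cfiBase G y) ∈ T') :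
    (cfiGraph G T).Adj x y ↔ (cfiGraph G T').Adj x y := by
  have key : ∀ a b : CFIVertex G,
      (s(cfiBase G a, cfiBase G b) ∈ T ↔ s(cfiBase G a, cfiBase G b) ∈ T') →
      (cfiRel G T a b ↔ cfiRel G T' a b) := by
    rintro (⟨u, S⟩ | ⟨⟨⟨u, w⟩, huw⟩, c⟩) (⟨u', S'⟩ | ⟨⟨⟨w', u'⟩, hwu⟩, c'⟩) hab <;>
      simp only [cfiRel]
    refine and_congr_right fun hw' => and_congr_right fun hu' => ?_
    subst hw' hu'
    exact iff_congr Iff.rfl (not_congr hab)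
  simp only [cfiGraph, SimpleGraph.fromRel_adj]
  rw [key x y h, key y x (by rwa [Sym2.eq_swap])]

/-! ### Gauge transformations (CFI's local isomorphisms, Lemma 6.2) -/

/-- The neighbours `w` of `u` whose dart `(u, w)` is marked by `g`. [folklore] -/
def gaugeSet (g : Fin v → Fin v → Bool) (u : Fin v) : Finset (Fin v) :=
  (G.neighborFinset u).filter fun w => g u w = true

/-- Marked darts at `u` point to neighbours of `u`. [folklore] -/
theorem gaugeSet_subset (g : Fin v → Fin v → Bool) (u : Fin v) :
    gaugeSet G g u ⊆ G.neighborFinset u :=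
  Finset.filter_subset _ _

variable {G} in
/-- Membership in `gaugeSet`. [folklore] -/
theorem mem_gaugeSet {g : Fin v → Fin v → Bool} {u w : Fin v} :
    w ∈ gaugeSet G g u ↔ G.Adj u w ∧ g u w = true := by
  simp [gaugeSet]

/-- `#(A Δ B)` is even when `#A` and `#B` are. [folklore] -/
theorem even_card_symmDiff_of_even {α : Type*} [DecidableEq α] {A B : Finset α}
    (hA : Even A.card) (hB : Even B.card) : Even (A ∆ B).card := by
  have h : (A ∆ B).card + 2 * (A ∩ B).card = A.card + B.card := by
    rw [Finset.symmDiff_def, Finset.card_union_of_disjoint disjoint_sdiff_sdiff]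
    have h1 := Finset.card_sdiff_add_card_inter A B
    have h2 := Finset.card_sdiff_add_card_inter B A
    rw [Finset.inter_comm B A] at h2
    omega
  rw [Nat.even_iff] at hA hB ⊢
  omega

/-- The GAUGE TRANSFORMATION of the CFI vertex set determined by a dart marking `g` with an
even number of marked darts at each vertex: end vertices `(u, w, c) ↦ (u, w, c ⊕ g(u,w))`,
gadget vertices `m_{u,S} ↦ m_{u, S Δ gaugeSet g u}`. [Cai–Fürer–Immerman 1992, Lemma 6.2]
[folklore] -/
def gaugeMap (g : Fin v → Fin v → Bool) (hg : ∀ u, Even (gaugeSet G g u).card) :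
    CFIVertex G → CFIVertex G
  | .inl ⟨u, S⟩ => .inl ⟨u, ⟨S.1 ∆ gaugeSet G g u,
      Finset.symmDiff_subset_union.trans (Finset.union_subset S.2.1 (gaugeSet_subset G g u)),
      even_card_symmDiff_of_even S.2.2 (hg u)⟩⟩
  | .inr (d, c) => .inr (d, c ^^ g d.1.1 d.1.2)

variable {G}

/-- A gauge transformation is an involution. [folklore] -/
theorem gaugeMap_gaugeMap (g : Fin v → Fin v → Bool) (hg : ∀ u, Even (gaugeSet G g u).card)
    (x : CFIVertex G) : gaugeMap G g hg (gaugeMap G g hg x) = x := by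
  rcases x with ⟨u, S, hS⟩ | ⟨d, c⟩
  · simp only [gaugeMap]
    exact congrArg Sum.inl (congrArg (Sigma.mk u)
      (Subtype.ext (symmDiff_symmDiff_cancel_right (gaugeSet G g u) S)))
  · simp only [gaugeMap, Bool.xor_assoc, Bool.xor_self, Bool.xor_false]

/-- A gauge transformation is injective. [folklore] -/
theorem gaugeMap_injective (g : Fin v → Fin v → Bool) (hg : ∀ u, Even (gaugeSet G g u).card) :
    Function.Injective (gaugeMap G g hg) :=
  Function.LeftInverse.injective (gaugeMap_gaugeMap g hg)

/-- A gauge transformation preserves gadgets (base vertices). [folklore] -/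
theorem cfiBase_gaugeMap (g : Fin v → Fin v → Bool) (hg : ∀ u, Even (gaugeSet G g u).card)
    (x : CFIVertex G) : cfiBase G (gaugeMap G g hg x) = cfiBase G x := by
  rcases x with ⟨u, S⟩ | ⟨d, c⟩ <;> rfl

/-- A gauge transformation is the identity on every gadget without marked darts. [folklore] -/
theorem gaugeMap_eq_self (g : Fin v → Fin v → Bool) (hg : ∀ u, Even (gaugeSet G g u).card)
    {x : CFIVertex G} (hx : ∀ w, g (cfiBase G x) w = false) : gaugeMap G g hg x = x := by
  rcases x with ⟨u, S, hS⟩ | ⟨d, c⟩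
  · have hx' : ∀ w, g u w = false := hx
    have hD : gaugeSet G g u = ∅ :=
      Finset.filter_eq_empty_iff.2 fun w _ => by simp [hx' w]
    have hSD : S ∆ gaugeSet G g u = S := by
      rw [hD]
      ext w
      simp [Finset.mem_symmDiff]
    simp only [gaugeMap]
    exact congrArg Sum.inl (congrArg (Sigma.mk u) (Subtype.ext hSD))
  · have hx' : g d.1.1 d.1.2 = false := hx d.1.2
    simp only [gaugeMap, hx', Bool.xor_false]

/-- Boolean bookkeeping for gadget–end adjacency under a gauge transformation. [folklore] -/
private theorem inl_inr_aux {S D : Finset (Fin v)} {w : Fin v} {c b : Bool}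
    (hD : w ∈ D ↔ b = true) :
    ((c ^^ b) = true ↔ w ∈ S ∆ D) ↔ (c = true ↔ w ∈ S) := by
  rw [Finset.mem_symmDiff]
  by_cases hw : w ∈ S <;> cases c <;> cases b <;> simp_all

/-- Boolean bookkeeping for end–end adjacency under a gauge transformation. [folklore] -/
private theorem inr_inr_aux (c c' a b : Bool) {P P' : Prop} (h : P' ↔ (P ↔ a = b)) :
    ((c ^^ a) = (c' ^^ b) ↔ ¬P') ↔ (c = c' ↔ ¬P) := by
  by_cases hP : P <;> cases c <;> cases c' <;> cases a <;> cases b <;> simp_all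

/-- The generating relation of `CFI(G, ·)` is transported by a gauge transformation from the
twist set `T` to any `T'` that differs from `T` exactly at the edges `{u, w}` with
`g(u,w) ≠ g(w,u)`. [Cai–Fürer–Immerman 1992, Lemma 6.2] [folklore] -/
theorem cfiRel_gaugeMap {g : Fin v → Fin v → Bool} (hg : ∀ u, Even (gaugeSet G g u).card)
    {T T' : Set (Sym2 (Fin v))} [DecidablePred (· ∈ T)] [DecidablePred (· ∈ T')]
    (hTT' : ∀ u w, G.Adj u w → (s(u, w) ∈ T' ↔ (s(u, w) ∈ T ↔ g u w = g w u)))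
    (x y : CFIVertex G) :
    cfiRel G T' (gaugeMap G g hg x) (gaugeMap G g hg y) ↔ cfiRel G T x y := by
  rcases x with ⟨u, S, hS⟩ | ⟨⟨⟨u, w⟩, huw⟩, c⟩ <;>
    rcases y with ⟨u', S', hS'⟩ | ⟨⟨⟨w', u'⟩, hwu⟩, c'⟩ <;>
    simp only [gaugeMap, cfiRel]
  · refine and_congr_right fun huw' => inl_inr_aux ?_
    subst huw'
    rw [mem_gaugeSet]
    exact ⟨fun h => h.2, fun h => ⟨hwu, h⟩⟩
  · refine and_congr_right fun hw' => and_congr_right fun hu' => ?_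
    subst hw' hu'
    exact inr_inr_aux _ _ _ _ (hTT' _ _ huw)

/-- Hence a gauge transformation is an isomorphism `CFI(G, T) ≅ CFI(G, T')`.
[Cai–Fürer–Immerman 1992, Lemma 6.2] [folklore] -/
theorem adj_gaugeMap {g : Fin v → Fin v → Bool} (hg : ∀ u, Even (gaugeSet G g u).card)
    {T T' : Set (Sym2 (Fin v))} [DecidablePred (· ∈ T)] [DecidablePred (· ∈ T')]
    (hTT' : ∀ u w, G.Adj u w → (s(u, w) ∈ T' ↔ (s(u, w) ∈ T ↔ g u w = g w u)))
    (x y : CFIVertex G) :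
    (cfiGraph G T').Adj (gaugeMap G g hg x) (gaugeMap G g hg y) ↔ (cfiGraph G T).Adj x y := by
  simp only [cfiGraph, SimpleGraph.fromRel_adj, ne_eq, (gaugeMap_injective g hg).eq_iff,
    cfiRel_gaugeMap hg hTT']

/-- **The gauge isomorphism** `CFI(G, T) ≃g CFI(G, T')` of an even dart marking `g`, for `T'`
differing from `T` exactly at the edges `{u,w}` with `g(u,w) ≠ g(w,u)` (CFI's Lemma 6.2 in the
form "twisting an even number of edge-pairs at each gadget is an isomorphism").
[Cai–Fürer–Immerman 1992, Lemma 6.2] [folklore] -/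
def gaugeIso {g : Fin v → Fin v → Bool} (hg : ∀ u, Even (gaugeSet G g u).card)
    {T T' : Set (Sym2 (Fin v))} [DecidablePred (· ∈ T)] [DecidablePred (· ∈ T')]
    (hTT' : ∀ u w, G.Adj u w → (s(u, w) ∈ T' ↔ (s(u, w) ∈ T ↔ g u w = g w u))) :
    cfiGraph G T ≃g cfiGraph G T' where
  toEquiv := ⟨gaugeMap G g hg, gaugeMap G g hg, gaugeMap_gaugeMap g hg, gaugeMap_gaugeMap g hg⟩
  map_rel_iff' := adj_gaugeMap hg hTT' _ _

/-- The gauge isomorphism preserves gadgets and fixes every gadget without marked darts.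
[Cai–Fürer–Immerman 1992, Lemma 6.2] [folklore] -/
theorem exists_gaugeIso {g : Fin v → Fin v → Bool} (hg : ∀ u, Even (gaugeSet G g u).card)
    {T T' : Set (Sym2 (Fin v))} [DecidablePred (· ∈ T)] [DecidablePred (· ∈ T')]
    (hTT' : ∀ u w, G.Adj u w → (s(u, w) ∈ T' ↔ (s(u, w) ∈ T ↔ g u w = g w u))) :
    ∃ φ : cfiGraph G T ≃g cfiGraph G T', (∀ x, cfiBase G (φ x) = cfiBase G x) ∧
      ∀ x, (∀ w, g (cfiBase G x) w = false) → φ x = x :=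
  ⟨gaugeIso hg hTT', cfiBase_gaugeMap g hg, fun _ hx => gaugeMap_eq_self g hg hx⟩

/-! ### Moving the twist along a walk -/

/-- The marking of the two darts at `a` towards `x` and towards `c` (nothing if `x = c`).
[folklore] -/
def bump (a x c : Fin v) : Fin v → Fin v → Bool :=
  fun u w => decide (u = a) && (decide (w = x) ^^ decide (w = c))

/-- `bump a x c` marks no dart away from `a`. [folklore] -/
theorem bump_of_ne {a x c u : Fin v} (hu : u ≠ a) (w : Fin v) : bump a x c u w = false := by
  simp [bump, hu]

/-- `bump a x c` has no marked darts at vertices other than `a`. [folklore] -/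
theorem gaugeSet_bump_of_ne {a x c u : Fin v} (hu : u ≠ a) : gaugeSet G (bump a x c) u = ∅ :=
  Finset.filter_eq_empty_iff.2 fun w _ => by simp [bump_of_ne hu]

/-- `bump a x c` marks an even number of darts (`0` or `2`) at every vertex, for neighbours
`x`, `c` of `a`. [folklore] -/
theorem even_card_gaugeSet_bump {a x c : Fin v} (hx : G.Adj a x) (hc : G.Adj a c) (u : Fin v) :
    Even (gaugeSet G (bump a x c) u).card := by
  by_cases hu : u = a
  · subst hu
    by_cases hxc : x = c
    · subst hxc
      have : gaugeSet G (bump u x x) u = ∅ :=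
        Finset.filter_eq_empty_iff.2 fun w _ => by simp [bump]
      simp [this]
    · have : gaugeSet G (bump u x c) u = {x, c} := by
        ext w
        rw [mem_gaugeSet, Finset.mem_insert, Finset.mem_singleton]
        constructor
        · rintro ⟨-, h⟩
          by_contra hw
          obtain ⟨hwx, hwc⟩ := not_or.1 hw
          simp [bump, hwx, hwc] at h
        · rintro (rfl | rfl)
          · exact ⟨hx, by simp [bump, hxc]⟩
          · exact ⟨hc, by simp [bump, Ne.symm hxc]⟩
      rw [this, Finset.card_pair hxc]
      exact ⟨1, rfl⟩
  · rw [gaugeSet_bump_of_ne hu]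
    simp

/-- The boundary of `bump a x c` is `{a,x} Δ {a,c}`. [folklore] -/
theorem bump_xor_bump {a x c u w : Fin v} (huw : u ≠ w) (hax : a ≠ x) (hac : a ≠ c) :
    (bump a x c u w ^^ bump a x c w u) =
      (decide (s(u, w) = s(a, x)) ^^ decide (s(u, w) = s(a, c))) := by
  unfold bump
  by_cases hu : u = a
  · subst hu
    simp [huw.symm, hax, hac]
  · by_cases hw : w = a
    · subst hw
      simp [hu]
    · simp [hu, hw]

/-- The marked darts of a pointwise `xor` of two markings form the symmetric difference.
[folklore] -/
theorem gaugeSet_xor (g h : Fin v → Fin v → Bool) (u : Fin v) :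
    gaugeSet G (fun a b => g a b ^^ h a b) u = gaugeSet G g u ∆ gaugeSet G h u := by
  ext w
  simp only [mem_gaugeSet, Finset.mem_symmDiff]
  cases g u w <;> cases h u w <;> simp

/-- Boolean bookkeeping: `xor` of boundaries. [folklore] -/
private theorem xor_aux₁ : ∀ p q r t : Bool, ((p ^^ q) ^^ (r ^^ t)) = ((p ^^ r) ^^ (q ^^ t)) := by
  decide

/-- Boolean bookkeeping: cancelling the middle edge. [folklore] -/
private theorem xor_aux₂ : ∀ m n k : Bool, ((m ^^ n) ^^ (k ^^ m)) = (k ^^ n) := by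
  decide

/-- **Moving the twist.** Along a walk `W : a ⟶ b` of `G` inside `U`, with darts `x ~ a` in
front and `b ~ y` behind, there is an even dart marking supported on `U` whose boundary
(the edges `{u,w}` with `g(u,w) ≠ g(w,u)`) is `{x,a} Δ {b,y}`: mark at each vertex of the walk
the darts towards its predecessor and its successor. [Cai–Fürer–Immerman 1992, §6 (proof of
Lemma 6.2 / Thm 6.4: the twist can be moved along paths)] [folklore] -/
theorem exists_gauge (U : Set (Fin v)) {y : Fin v} :
    ∀ {a b : Fin v} (W : G.Walk a b) {x : Fin v}, G.Adj x a → G.Adj b y →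
      (∀ z ∈ W.support, z ∈ U) →
      ∃ g : Fin v → Fin v → Bool, (∀ u, Even (gaugeSet G g u).card) ∧
        (∀ u, u ∉ U → ∀ w, g u w = false) ∧
        ∀ u w, G.Adj u w →
          (g u w ^^ g w u) = (decide (s(u, w) = s(x, a)) ^^ decide (s(u, w) = s(b, y))) := by
  intro a b W
  induction W with
  | @nil a =>
    intro x hxa hay hU
    have haU : a ∈ U := hU a (SimpleGraph.Walk.start_mem_support _)
    refine ⟨bump a x y, even_card_gaugeSet_bump hxa.symm hay, fun u hu w =>
      bump_of_ne (fun h : u = a => hu (h ▸ haU)) w, fun u w huw => ?_⟩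
    rw [bump_xor_bump huw.ne hxa.ne.symm hay.ne, Sym2.eq_swap (a := x)]
  | @cons a c b h W' ih =>
    intro x hxa hby hU
    have haU : a ∈ U := hU a (SimpleGraph.Walk.start_mem_support _)
    obtain ⟨g', hg'even, hg'supp, hg'bd⟩ :=
      ih h hby fun z hz => hU z (by simp [hz])
    refine ⟨fun u w => g' u w ^^ bump a x c u w, fun u => ?_, fun u hu w => ?_,
      fun u w huw => ?_⟩
    · rw [gaugeSet_xor]
      exact even_card_symmDiff_of_even (hg'even u) (even_card_gaugeSet_bump hxa.symm h u)
    · have hua : u ≠ a := fun h' => hu (h' ▸ haU)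
      simp [hg'supp u hu w, bump_of_ne hua]
    · rw [xor_aux₁, hg'bd u w huw, bump_xor_bump huw.ne hxa.ne.symm h.ne, xor_aux₂,
        Sym2.eq_swap (a := x)]

/-- From the boundary of a marking to the relation between the two twist sets it connects
(first orientation). [folklore] -/
private theorem twist_aux₁ {a b : Bool} {P Q : Prop} [Decidable P] [Decidable Q]
    (h : (a ^^ b) = (decide P ^^ decide Q)) : Q ↔ (P ↔ a = b) := by
  by_cases hP : P <;> by_cases hQ : Q <;> cases a <;> cases b <;> simp_all

/-- From the boundary of a marking to the relation between the two twist sets it connects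
(second orientation). [folklore] -/
private theorem twist_aux₂ {a b : Bool} {P Q : Prop} [Decidable P] [Decidable Q]
    (h : (a ^^ b) = (decide P ^^ decide Q)) : P ↔ (Q ↔ a = b) := by
  by_cases hP : P <;> by_cases hQ : Q <;> cases a <;> cases b <;> simp_all

end Gauge

/-! ### The big component -/

section BigPart

variable {v : ℕ} (G : SimpleGraph (Fin v))

/-- The vertices reachable from `x` by a walk of `G` avoiding `Bs`. [folklore] -/
def reachAvoid (Bs : Set (Fin v)) (x : Fin v) : Set (Fin v) :=
  {y | ∃ W : G.Walk x y, ∀ z ∈ W.support, z ∉ Bs}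

/-- The BIG PART of `G - Bs`: the vertices from which more than half of all vertices are
reachable avoiding `Bs` (the union of the connected components of `G - Bs` with more than
`v / 2` vertices — there is at most one). [Cai–Fürer–Immerman 1992, Def. 6.3 and proof of
Thm 6.4] [folklore] -/
def bigPart (Bs : Set (Fin v)) : Set (Fin v) :=
  {x | v < 2 * (reachAvoid G Bs x).ncard}

/-- The big part of `G - Bs` avoids `Bs`. [folklore] -/
theorem not_mem_of_mem_bigPart {Bs : Set (Fin v)} {x : Fin v} (hx : x ∈ bigPart G Bs) :
    x ∉ Bs := by
  intro hxB
  have : reachAvoid G Bs x = ∅ :=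
    Set.eq_empty_iff_forall_notMem.2 fun y ⟨W, hW⟩ => hW x W.start_mem_support hxB
  simp [bigPart, this] at hx

/-- Reachability avoiding a set is antitone in the set. [folklore] -/
theorem reachAvoid_anti {Bs Bs' : Set (Fin v)} (h : Bs ⊆ Bs') (x : Fin v) :
    reachAvoid G Bs' x ⊆ reachAvoid G Bs x :=
  fun _ ⟨W, hW⟩ => ⟨W, fun z hz hzB => hW z hz (h hzB)⟩

/-- The big part is antitone: pebbling more base vertices shrinks it (`Q_{r+1} ⊆ Q_r` in CFI's
proof of Thm 6.4). [Cai–Fürer–Immerman 1992, proof of Thm 6.4] [folklore] -/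
theorem bigPart_anti {Bs Bs' : Set (Fin v)} (h : Bs ⊆ Bs') : bigPart G Bs' ⊆ bigPart G Bs :=
  fun x hx => lt_of_lt_of_le hx
    (Nat.mul_le_mul_left 2 (Set.ncard_le_ncard (reachAvoid_anti G h x)))

/-- Any two vertices of the big part are joined by a walk avoiding `Bs` (two disjoint sets of
more than `v / 2` vertices each cannot exist). [Cai–Fürer–Immerman 1992, proof of Thm 6.4]
[folklore] -/
theorem exists_walk_of_mem_bigPart {Bs : Set (Fin v)} {a b : Fin v} (ha : a ∈ bigPart G Bs)
    (hb : b ∈ bigPart G Bs) : ∃ W : G.Walk a b, ∀ z ∈ W.support, z ∉ Bs := by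
  by_contra hab
  have hdisj : Disjoint (reachAvoid G Bs a) (reachAvoid G Bs b) := by
    rw [Set.disjoint_left]
    rintro y ⟨Wa, hWa⟩ ⟨Wb, hWb⟩
    refine hab ⟨Wa.append Wb.reverse, fun z hz => ?_⟩
    rw [SimpleGraph.Walk.mem_support_append_iff, SimpleGraph.Walk.support_reverse,
      List.mem_reverse] at hz
    rcases hz with hz | hz
    · exact hWa z hz
    · exact hWb z hz
  have h1 : (reachAvoid G Bs a ∪ reachAvoid G Bs b).ncard ≤ v := by
    calc (reachAvoid G Bs a ∪ reachAvoid G Bs b).ncard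
        ≤ (Set.univ : Set (Fin v)).ncard := Set.ncard_le_ncard (Set.subset_univ _)
      _ = v := by rw [Set.ncard_univ, Nat.card_eq_fintype_card, Fintype.card_fin]
  rw [Set.ncard_union_eq hdisj] at h1
  simp only [bigPart, Set.mem_setOf_eq] at ha hb
  omega

/-- If `Bs` is not a separator (CFI Def. 6.3) and `G` has at least two vertices, the big part
of `G - Bs` contains an edge. [Cai–Fürer–Immerman 1992, Def. 6.3] [folklore] -/
theorem exists_adj_bigPart (h2 : 2 ≤ v) {Bs : Set (Fin v)} (hBs : ¬ IsCFISeparator G Bs) :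
    ∃ a b, a ∈ bigPart G Bs ∧ b ∈ bigPart G Bs ∧ G.Adj a b := by
  simp only [IsCFISeparator, not_forall, not_le] at hBs
  obtain ⟨C, hC⟩ := hBs
  have hreach : ∀ x₀ ∈ C.supp, Subtype.val '' C.supp ⊆ reachAvoid G Bs x₀.val := by
    rintro x₀ hx₀ _ ⟨y, hy, rfl⟩
    rw [SimpleGraph.ConnectedComponent.mem_supp_iff] at hx₀ hy
    obtain ⟨W⟩ := SimpleGraph.ConnectedComponent.exact (hx₀.trans hy.symm)
    have hW : ∀ z ∈ (W.map (SimpleGraph.Embedding.induce Bsᶜ).toHom).support, z ∉ Bs := by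
      intro z hz
      simp only [SimpleGraph.Walk.support_map, List.mem_map] at hz
      obtain ⟨z', -, rfl⟩ := hz
      exact z'.2
    exact ⟨_, hW⟩
  have hbig : ∀ x₀ ∈ C.supp, (x₀ : Fin v) ∈ bigPart G Bs := fun x₀ hx₀ => by
    have h := Set.ncard_le_ncard (hreach x₀ hx₀) (Set.toFinite _)
    rw [Set.ncard_image_of_injective _ Subtype.val_injective] at h
    show v < 2 * _
    omega
  have h1 : 1 < C.supp.ncard := by omega
  obtain ⟨x₀, hx₀, y₀, hy₀, hne⟩ := (Set.one_lt_ncard (Set.toFinite _)).1 h1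
  have hxy : (G.induce Bsᶜ).Reachable x₀ y₀ := by
    rw [SimpleGraph.ConnectedComponent.mem_supp_iff] at hx₀ hy₀
    exact SimpleGraph.ConnectedComponent.exact (hx₀.trans hy₀.symm)
  obtain ⟨W⟩ := hxy
  cases W with
  | nil => exact (hne rfl).elim
  | cons hadj W' =>
    refine ⟨x₀, _, hbig x₀ hx₀, hbig _ ?_, hadj⟩
    rw [SimpleGraph.ConnectedComponent.mem_supp_iff] at hx₀ ⊢
    rw [← hx₀]
    exact SimpleGraph.ConnectedComponent.connectedComponentMk_eq_of_adj hadj.symm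

end BigPart

/-! ### Duplicator's strategy -/

section Strategy

variable {v : ℕ} (G : SimpleGraph (Fin v)) [DecidableRel G.Adj]

/-- The base vertices of the pebbled vertices of a position. [folklore] -/
def basesOf (p : Set (CFIVertex G × CFIVertex G)) : Set (Fin v) :=
  (fun x => cfiBase G x.1) '' p

/-- `basesOf` is monotone. [folklore] -/
theorem basesOf_mono {p q : Set (CFIVertex G × CFIVertex G)} (h : q ⊆ p) :
    basesOf G q ⊆ basesOf G p :=
  Set.image_mono h

/-- `basesOf` of a position with one more pebble pair. [folklore] -/
theorem basesOf_insert (x : CFIVertex G × CFIVertex G) (p : Set (CFIVertex G × CFIVertex G)) :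
    basesOf G (insert x p) = insert (cfiBase G x.1) (basesOf G p) :=
  Set.image_insert_eq

/-- A position pebbles at most as many gadgets as it has pebble pairs. [folklore] -/
theorem ncard_basesOf_le {p : Set (CFIVertex G × CFIVertex G)} (hp : p.Finite) :
    (basesOf G p).ncard ≤ p.ncard :=
  Set.ncard_image_le hp


/-- The WINNING POSITIONS of Duplicator on `CFI(G, ∅)` versus `CFI(G, T₁)` (`T₁` a single edge):
at most `s` pebble pairs `p`, an edge `{a, b}` inside the big part of `G` minus the pebbled base
vertices, and a gadget-preserving isomorphism `φ : CFI(G, {a,b}) ≅ CFI(G, T₁)` whose graph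
contains `p` — "the twist is hidden in the big component". [Cai–Fürer–Immerman 1992, proof of
Thm 6.4] [folklore] -/
def cfiStrategyCarrier (T₁ : Set (Sym2 (Fin v))) [DecidablePred (· ∈ T₁)] (s : ℕ) :
    Set (Set (CFIVertex G × CFIVertex G)) :=
  {p | p.Finite ∧ p.ncard ≤ s ∧ ∃ a b : Fin v, a ∈ bigPart G (basesOf G p) ∧
      b ∈ bigPart G (basesOf G p) ∧ G.Adj a b ∧
      ∃ φ : cfiGraph G ({s(a, b)} : Set (Sym2 (Fin v))) ≃g cfiGraph G T₁,
        (∀ x, cfiBase G (φ x) = cfiBase G x) ∧ ∀ x ∈ p, x.2 = φ x.1}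

/-- **Cai–Fürer–Immerman, Thm 6.4 (game form), for a general presentation of the one-edge twist
set.** If `G` is connected and every separator of `G` has at least `s + 1` vertices, Duplicator
wins the bijective `s`-pebble game on `CFI(G, ∅)` and `CFI(G, T₁)` whenever `T₁ ∩ E(G)` is a
single edge. [Cai–Fürer–Immerman 1992, Thm 6.4] [cite: CaiFurerImmerman1992, Theorem 6.4] -/
theorem ckEquiv_cfiEven_cfiGraph_of_separator {s : ℕ} (hconn : G.Connected)
    (hsep : ∀ S : Set (Fin v), IsCFISeparator G S → s + 1 ≤ S.ncard)
    {x₁ y₁ : Fin v} (he : G.Adj x₁ y₁) (T₁ : Set (Sym2 (Fin v))) [DecidablePred (· ∈ T₁)]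
    (hT₁ : ∀ u w, G.Adj u w → (s(u, w) ∈ T₁ ↔ s(u, w) = s(x₁, y₁))) :
    CkEquiv s (cfiEven G) (cfiGraph G T₁) := by
  have h2 : 2 ≤ v := by
    have h1 := x₁.2
    have h2 := y₁.2
    have : (x₁ : ℕ) ≠ y₁ := fun h => he.ne (Fin.ext h)
    omega
  have hnotsep : ∀ Bs : Set (Fin v), Bs.ncard ≤ s → ¬ IsCFISeparator G Bs :=
    fun Bs hBs hS => absurd (hsep Bs hS) (by omega)
  refine ⟨{ carrier := cfiStrategyCarrier G T₁ s
            empty_mem := ?_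
            finite_of_mem := fun p hp => hp.1
            ncard_le_of_mem := fun p hp => hp.2.1
            isPartialIso_of_mem := ?_
            mem_of_subset := ?_
            forth := ?_ }⟩
  · -- the initial position: twist at an edge of the big part of `G` itself, moved from `{x₁,y₁}`
    refine ⟨Set.finite_empty, by simp, ?_⟩
    have h0 : (basesOf G (∅ : Set (CFIVertex G × CFIVertex G))).ncard ≤ s := by
      simp [basesOf]
    obtain ⟨a, b, ha, hb, hab⟩ := exists_adj_bigPart G h2 (hnotsep _ h0)
    obtain ⟨W⟩ := hconn.preconnected b x₁
    obtain ⟨g, hg, -, hbd⟩ := exists_gauge (G := G) Set.univ W hab he fun z _ => Set.mem_univ z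
    obtain ⟨φ, hφ, -⟩ := exists_gaugeIso (G := G) hg (T := ({s(a, b)} : Set (Sym2 (Fin v))))
      (T' := T₁) fun u w huw => by
        rw [hT₁ u w huw, Set.mem_singleton_iff]
        exact twist_aux₁ (hbd u w huw)
    exact ⟨a, b, ha, hb, hab, φ, hφ, fun x hx => (Set.notMem_empty x hx).elim⟩
  · -- winning positions are partial isomorphisms `CFI(G,∅) ⇀ CFI(G,T₁)`
    rintro p ⟨-, -, a, b, ha, hb, -, φ, -, hφp⟩
    have hpi : IsPartialIso (cfiGraph G ({s(a, b)} : Set (Sym2 (Fin v)))) (cfiGraph G T₁) p :=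
      IsPartialIso.of_iso φ hφp
    refine ⟨hpi.eq_iff, fun x hx y hy => ?_⟩
    rw [← hpi.adj_iff hx hy, ← cfiGraph_empty]
    refine cfiGraph_adj_congr_of_base G ?_
    simp only [Set.mem_empty_iff_false, Set.mem_singleton_iff, false_iff]
    intro heq
    have hx' : cfiBase G x.1 ∈ basesOf G p := ⟨x, hx, rfl⟩
    have ha' := not_mem_of_mem_bigPart G ha
    have hb' := not_mem_of_mem_bigPart G hb
    rw [Sym2.eq_iff] at heq
    rcases heq with ⟨h1, -⟩ | ⟨h1, -⟩
    · exact ha' (h1 ▸ hx')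
    · exact hb' (h1 ▸ hx')
  · -- closure under lifting pebbles
    rintro p ⟨hfin, hcard, a, b, ha, hb, hab, φ, hφ, hφp⟩ q hqp
    have hB : basesOf G q ⊆ basesOf G p := basesOf_mono G hqp
    exact ⟨hfin.subset hqp, (Set.ncard_le_ncard hqp hfin).trans hcard, a, b,
      bigPart_anti G hB ha, bigPart_anti G hB hb, hab, φ, hφ, fun x hx => hφp x (hqp hx)⟩
  · -- the bijective forth property
    rintro p ⟨hfin, hcard, a, b, ha, hb, hab, φ, hφ, hφp⟩ hlt
    have key : ∀ z : Fin v, ∃ a' b' : Fin v, a' ∈ bigPart G (insert z (basesOf G p)) ∧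
        b' ∈ bigPart G (insert z (basesOf G p)) ∧ G.Adj a' b' ∧
        ∃ ψ : cfiGraph G ({s(a', b')} : Set (Sym2 (Fin v))) ≃g cfiGraph G T₁,
          (∀ x, cfiBase G (ψ x) = cfiBase G x) ∧
            ∀ x, cfiBase G x ∈ basesOf G p → ψ x = φ x := by
      intro z
      have hBz : (insert z (basesOf G p)).ncard ≤ s := by
        have h₁ := Set.ncard_insert_le z (basesOf G p)
        have h₂ := ncard_basesOf_le G hfin
        omega
      obtain ⟨a', b', ha', hb', hab'⟩ := exists_adj_bigPart G h2 (hnotsep _ hBz)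
      have hsub : basesOf G p ⊆ insert z (basesOf G p) := Set.subset_insert _ _
      obtain ⟨W, hW⟩ := exists_walk_of_mem_bigPart G hb (bigPart_anti G hsub ha')
      obtain ⟨g, hg, hgsupp, hbd⟩ :=
        exists_gauge (G := G) (basesOf G p)ᶜ W hab hab' fun z hz => hW z hz
      obtain ⟨ψ, hψ, hψfix⟩ := exists_gaugeIso (G := G) hg
        (T := ({s(a', b')} : Set (Sym2 (Fin v)))) (T' := ({s(a, b)} : Set (Sym2 (Fin v))))
        fun u w huw => by
          rw [Set.mem_singleton_iff, Set.mem_singleton_iff]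
          exact twist_aux₂ (hbd u w huw)
      refine ⟨a', b', ha', hb', hab', ψ.trans φ, fun x => (hφ _).trans (hψ x), fun x hx => ?_⟩
      show φ (ψ x) = φ x
      rw [hψfix x fun w => hgsupp _ (fun h => h hx) w]
    choose fa fb hfa hfb hfab ψ hψbase hψfix using key
    -- Duplicator's bijection: on the gadget over `z`, play `ψ z`
    have hgen : ∀ (z₁ z₂ : Fin v) (x y : CFIVertex G), z₁ = z₂ → ψ z₁ x = ψ z₂ y → x = y := by
      rintro z₁ _ x y rfl h
      exact (ψ z₁).injective h
    have hFinj : Function.Injective fun x : CFIVertex G => ψ (cfiBase G x) x := by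
      intro x y hxy
      refine hgen (cfiBase G x) (cfiBase G y) x y ?_ hxy
      have h := congrArg (cfiBase G) hxy
      simpa only [hψbase] using h
    refine ⟨Equiv.ofBijective _ (Finite.injective_iff_bijective.1 hFinj), fun x => ?_⟩
    refine ⟨hfin.insert _, (Set.ncard_insert_le _ _).trans (Nat.succ_le_of_lt hlt),
      fa (cfiBase G x), fb (cfiBase G x), ?_, ?_, hfab _, ψ (cfiBase G x), hψbase _, ?_⟩
    · rw [basesOf_insert]
      exact hfa _
    · rw [basesOf_insert]
      exact hfb _
    · rintro y (rfl | hy)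
      · rfl
      · rw [hψfix _ y.1 ⟨y, hy, rfl⟩]
        exact hφp y hy

/-- **The Cai–Fürer–Immerman theorem (game form), discharge of the named fact
`caiFurerImmerman_cfiEquiv`.** For a connected base graph `T` (of minimum degree `≥ 2`) all of
whose separators (Def. 6.3) have at least `s + 1` vertices, and any edge `e` of `T`, Duplicator
wins the bijective `s`-pebble game on `CFI(T, ∅)` and `CFI(T, {e})`: `X(T) ≡_{C^s} X̃(T)`.
Proof: `ckEquiv_cfiEven_cfiGraph_of_separator` (the strategy "hide the twist in the big
component", with gauge isomorphisms moving the twist). [Cai–Fürer–Immerman 1992, Thm 6.4]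
[cite: CaiFurerImmerman1992, Theorem 6.4] -/
theorem caiFurerImmerman_cfiEquiv_holds : caiFurerImmerman_cfiEquiv := by
  intro v s T _ hconn _ hsep e
  induction e using Sym2.ind with
  | _ x₁ y₁ =>
    intro he _
    exact ckEquiv_cfiEven_cfiGraph_of_separator T hconn hsep
      (by simpa [SimpleGraph.mem_edgeSet] using he) _
      fun u w _ => Set.mem_singleton_iff

end Strategy

end Literature.ModelTheory.FiniteModelTheory
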